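import Mathlib.Combinatorics.SimpleGraph.Walk.Operations
import Mathlib.MeasureTheory.Measure.Dirac
import Mathlib.MeasureTheory.Measure.Count
import Literature.Probability.LatticeModels.DomainDiscretisation
import HarnessLib

/-!
# The simple-random-walk excursion measure of a discrete domain `Ω_δ`

Topic `Probability/LatticeModels`; namespace `Literature.Probability.LatticeModels` (path namespace,
sub-namespace `RWPath` for dot notation).  DEFINITIONS answering the request
`LatticeModels.rwExcursionMeasure` (route `SAWPoissonBanks`, item stmt-CriticalPhenomena-4779
`MutualAvoidanceLaw`; idea cards excursion-cocycle-five-eighths / saw-excursion-power-law), in the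
tree's discretisation vocabulary (`DomainDiscretisation.lean`): vertices `meshDomain Ω δ`, graph
`Ω_δ = discreteDomainGraph Ω δ`, discrete boundary `meshBoundary Ω δ`, discrete arcs
`discreteArc Ω δ A`.

Source: M. J. Kozdron, *On the scaling limit of simple random walk excursion measure in the
plane*, ALEA 2 (2006) 125–155 = arXiv:math/0506337 (held), §3.5, Definition 3.34 and the
paragraph following it:

> "A discrete excursion in `A` is a path `ω := [ω₀, ω₁, …, ω_k]` where `ω₀ ∈ ∂A`, `ω_k ∈ ∂A`,
> `|ωᵢ - ω_{i-1}| = 1` for `i = 1, …, k`, and `ωᵢ ∈ A` for `i = 1, …, k-1` … define the length of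
> `ω`, written `|ω|`, to be `k`. … define discrete excursion measure to be the measure that assigns
> weight `4^{-|ω|}` to each discrete excursion `ω`. Denote this measure by `μ^{RW}_{∂A}(·)` so that
> `μ^{RW}_{∂A}(ω) := 4^{-|ω|}`. Write `μ^{RW}_{∂A}(x,y)` to denote the measure on discrete
> excursions from `x` to `y` in `A`, and `μ^{RW}_{∂A}(Γ,Υ) := Σ_{x ∈ Γ} Σ_{y ∈ Υ} μ^{RW}_{∂A}(x,y)`
> … In [LawW1], Lawler and Werner defined `μ^{RW}_{∂A}(ω) := (2π 4^{|ω|})⁻¹`; this difference only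
> affects things up to a constant."

## Contents

* `RWPath Ω δ` — the nearest-neighbour paths of `Ω_δ`: the sigma type of walks of
  `discreteDomainGraph Ω δ` between any two sites, with the discrete σ-algebra `⊤`; `RWPath.len`,
  `RWPath.reverse` (an involution).
* `RWPath.IsExcursion` — the request's convention: length `n ≥ 1`, both endpoints in the discrete
  boundary `meshBoundary Ω δ`, and the INTERMEDIATE vertices `ω₁, …, ω_{n-1}` off the boundary
  (they lie in `meshDomain Ω δ ∖ meshBoundary Ω δ` automatically, being vertices of edges of
  `Ω_δ`); `RWPath.excursionWeight ω = 4^{-n} 𝟙[ω is an excursion]`.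
* `rwExcursionMeasure Ω δ : Measure (RWPath Ω δ)` — the weighted counting measure
  `Σ_ω 4^{-|ω|} δ_ω` over excursions (`rwExcursionMeasure_apply`: `μ(S) = Σ'_{ω ∈ S} w(ω)`).
* Restricted masses: `rwExcursionMass Ω δ A B = μ{ω : ω₀ ∈ discreteArc Ω δ A, ω_n ∈ discreteArc Ω δ B}`
  (Kozdron's `μ^{RW}_{∂A}(Γ, Υ)` evaluated on all excursions) and
  `rwExcursionMassHitting Ω δ A B K` (those excursions whose trace, drawn at mesh `δ` through
  `meshPoint δ`, meets a set `K ⊆ ℂ`, e.g. a hull).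
* API: unfolding lemmas, `excursionWeight_le_one`, reversal symmetry
  (`isExcursion_reverse_iff`, `excursionWeight_reverse`, `rwExcursionMass_comm`).

## Conventions and faithfulness

* Kozdron's boundary `∂A` is the OUTER vertex boundary of `A ⊆ ℤ²` and his excursions have
  `k ≥ 2`; the request (and this file) use the tree's discrete boundary `meshBoundary Ω δ` — a set of
  VERTICES OF `Ω_δ` (those with a `ℤ²`-neighbour not joined to them in `Ω_δ`) — as the set where
  excursions start and end, the interior being `meshDomain ∖ meshBoundary`, and allow `n ≥ 1` (a
  single boundary-to-boundary edge is an excursion, counted once).  The weight `4^{-n}` per path of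
  `n` steps is Kozdron's / Lawler's normalisation verbatim.
* Paths are walks of the graph `Ω_δ` (edges whose rescaled closed segment lies in `Ω̄`, CHI
  convention of `meshGraph`), so an excursion never jumps across a slit.
* The measure lives on the countable type `RWPath Ω δ` with `MeasurableSpace := ⊤` (as the tree's
  `YBWalk` SAW measures, `Literature/Probability/RandomPlanarGeometry/YangBaxterSAWLaw.lean`); the
  push-forward to curves (`SimpleGraph.Walk.toCurve (meshPoint δ)`, Kozdron (3.16)) is left to
  consumers.  Values in `ℝ≥0∞`; finiteness of the total mass for bounded `Ω`, `δ > 0` (killed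
  sub-Markovian weights: mass from each boundary vertex `≤ 1`) is a theorem for a proofs file, not
  part of the definition.  Not here: the scaling limit `δ → 0` (Kozdron 2006 Thm. 1.1 / 5.x — a
  cite fact), the last-exit decomposition.

## References

* M. J. Kozdron, ALEA 2 (2006) 125–155, arXiv:math/0506337, §3.5 Def. 3.34. [Kozdron2005]
* G. F. Lawler, *Conformally Invariant Processes in the Plane*, AMS 2005, §9.1 (continuum
  excursion measure). [Lawler2005]
-/

noncomputable section

open MeasureTheory Set
open scoped ENNReal

namespace Literature.Probability.LatticeModels

/-! ### Nearest-neighbour paths of `Ω_δ` -/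

/-- **The nearest-neighbour paths of the discrete domain `Ω_δ`**: pairs of sites `(x, y)` together
with a walk of the graph `Ω_δ = discreteDomainGraph Ω δ` from `x` to `y` (Kozdron's paths
`[ω₀, …, ω_k]` with `|ωᵢ - ω_{i-1}| = 1`, here along edges of `Ω_δ`). [cite: Kozdron2005, §3.5 Definition 3.34] -/
def RWPath (Ω : Set ℂ) (δ : ℝ) : Type :=
  Σ p : Site 2 × Site 2, (discreteDomainGraph Ω δ).Walk p.1 p.2

namespace RWPath

variable {Ω : Set ℂ} {δ : ℝ}

/-- Discrete σ-algebra on paths (every set of paths is an event). [folklore] -/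
instance instMeasurableSpace : MeasurableSpace (RWPath Ω δ) := ⊤

/-- Every set of paths is measurable. [folklore] -/
theorem measurableSet (S : Set (RWPath Ω δ)) : MeasurableSet S := MeasurableSpace.measurableSet_top

/-- Singletons of paths are measurable. [folklore] -/
instance instMeasurableSingletonClass : MeasurableSingletonClass (RWPath Ω δ) :=
  ⟨fun _ => measurableSet _⟩

/-- The starting site `ω₀`. [cite: Kozdron2005, §3.5 Definition 3.34] -/
def start (ω : RWPath Ω δ) : Site 2 := ω.1.1

/-- The final site `ω_n`. [cite: Kozdron2005, §3.5 Definition 3.34] -/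
def finish (ω : RWPath Ω δ) : Site 2 := ω.1.2

/-- The underlying walk of `Ω_δ`. [folklore] -/
def walk (ω : RWPath Ω δ) : (discreteDomainGraph Ω δ).Walk ω.start ω.finish := ω.2

/-- The length `|ω| = n` (number of steps). [cite: Kozdron2005, §3.5 Definition 3.34] -/
def len (ω : RWPath Ω δ) : ℕ := ω.2.length

/-- The `i`-th vertex `ωᵢ` (`ω₀ = start`, `ω_n = finish`, constant beyond `n`;
Mathlib `SimpleGraph.Walk.getVert`). [folklore] -/
def vert (ω : RWPath Ω δ) (i : ℕ) : Site 2 := ω.2.getVert i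

/-- Build a path from a walk. [folklore] -/
def mk {x y : Site 2} (w : (discreteDomainGraph Ω δ).Walk x y) : RWPath Ω δ := ⟨(x, y), w⟩

/-- The path of a walk starts at its origin. [folklore] -/
@[simp] theorem start_mk {x y : Site 2} (w : (discreteDomainGraph Ω δ).Walk x y) :
    (mk w).start = x := rfl

/-- The path of a walk ends at its target. [folklore] -/
@[simp] theorem finish_mk {x y : Site 2} (w : (discreteDomainGraph Ω δ).Walk x y) :
    (mk w).finish = y := rfl

/-- The path of a walk has its length. [folklore] -/
@[simp] theorem len_mk {x y : Site 2} (w : (discreteDomainGraph Ω δ).Walk x y) :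
    (mk w).len = w.length := rfl

/-- The vertices of the path of a walk. [folklore] -/
@[simp] theorem vert_mk {x y : Site 2} (w : (discreteDomainGraph Ω δ).Walk x y) (i : ℕ) :
    (mk w).vert i = w.getVert i := rfl

/-- `ω₀` is the `0`-th vertex. [folklore] -/
@[simp] theorem vert_zero (ω : RWPath Ω δ) : ω.vert 0 = ω.start := ω.2.getVert_zero

/-- `ω_n` is the last vertex. [folklore] -/
@[simp] theorem vert_len (ω : RWPath Ω δ) : ω.vert ω.len = ω.finish := ω.2.getVert_length

/-- **Time reversal** `[ω₀, …, ω_n] ↦ [ω_n, …, ω₀]` (Mathlib `SimpleGraph.Walk.reverse`). [folklore] -/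
def reverse (ω : RWPath Ω δ) : RWPath Ω δ := ⟨(ω.1.2, ω.1.1), ω.2.reverse⟩

/-- The reversed path starts at the end. [folklore] -/
@[simp] theorem start_reverse (ω : RWPath Ω δ) : ω.reverse.start = ω.finish := rfl

/-- The reversed path ends at the start. [folklore] -/
@[simp] theorem finish_reverse (ω : RWPath Ω δ) : ω.reverse.finish = ω.start := rfl

/-- Reversal preserves the length. [folklore] -/
@[simp] theorem len_reverse (ω : RWPath Ω δ) : ω.reverse.len = ω.len :=
  SimpleGraph.Walk.length_reverse _

/-- The vertices of the reversed path: `(ω.reverse)ᵢ = ω_{n-i}`. [folklore] -/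
theorem vert_reverse (ω : RWPath Ω δ) (i : ℕ) : ω.reverse.vert i = ω.vert (ω.len - i) :=
  SimpleGraph.Walk.getVert_reverse _ _

/-- Reversal is an involution. [folklore] -/
@[simp] theorem reverse_reverse (ω : RWPath Ω δ) : ω.reverse.reverse = ω := by
  obtain ⟨⟨x, y⟩, w⟩ := ω
  simp only [reverse]
  congr 1
  exact SimpleGraph.Walk.reverse_reverse w

/-- Reversal as a permutation of the paths. [folklore] -/
def reverseEquiv : RWPath Ω δ ≃ RWPath Ω δ where
  toFun := reverse
  invFun := reverse
  left_inv := reverse_reverse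
  right_inv := reverse_reverse

/-- `reverseEquiv` is `reverse`. [folklore] -/
@[simp] theorem reverseEquiv_apply (ω : RWPath Ω δ) : reverseEquiv ω = ω.reverse := rfl

/-! ### Excursions and their weight -/

variable (Ω δ) in
/-- **`ω` is a (discrete) excursion of `Ω_δ`**: it has `n ≥ 1` steps, starts and ends on the
discrete boundary `meshBoundary Ω δ`, and its intermediate vertices `ω₁, …, ω_{n-1}` are off the
boundary (hence in `meshDomain Ω δ ∖ meshBoundary Ω δ`).  Kozdron's Definition 3.34 with the
tree's vertex boundary of `Ω_δ` in place of the outer boundary `∂A`, and `n ≥ 1` allowed (module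
docstring). [cite: Kozdron2005, §3.5 Definition 3.34] -/
def IsExcursion (ω : RWPath Ω δ) : Prop :=
  0 < ω.len ∧ ω.start ∈ meshBoundary Ω δ ∧ ω.finish ∈ meshBoundary Ω δ ∧
    ∀ i, 0 < i → i < ω.len → ω.vert i ∉ meshBoundary Ω δ

/-- Unfolding lemma for `IsExcursion`. [folklore] -/
theorem isExcursion_iff (ω : RWPath Ω δ) :
    IsExcursion Ω δ ω ↔ 0 < ω.len ∧ ω.start ∈ meshBoundary Ω δ ∧ ω.finish ∈ meshBoundary Ω δ ∧
      ∀ i, 0 < i → i < ω.len → ω.vert i ∉ meshBoundary Ω δ :=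
  Iff.rfl

/-- **Reversal symmetry of excursions**: `ω` is an excursion iff its reversal is. [folklore] -/
theorem isExcursion_reverse_iff (ω : RWPath Ω δ) :
    IsExcursion Ω δ ω.reverse ↔ IsExcursion Ω δ ω := by
  simp only [isExcursion_iff, len_reverse, start_reverse, finish_reverse, vert_reverse]
  refine and_congr_right fun hlen => ?_
  rw [← and_assoc, ← and_assoc, and_comm (a := ω.finish ∈ _)]
  refine and_congr_right fun _ => ⟨fun h i hi hil => ?_, fun h i hi hil => ?_⟩
  · have := h (ω.len - i) (Nat.sub_pos_of_lt hil) (Nat.sub_lt hlen hi)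
    rwa [Nat.sub_sub_self hil.le] at this
  · exact h (ω.len - i) (Nat.sub_pos_of_lt hil) (Nat.sub_lt hlen hi)

open Classical in
variable (Ω δ) in
/-- **The excursion weight** `w(ω) = 4^{-|ω|}` if `ω` is an excursion of `Ω_δ`, and `0` otherwise
("define discrete excursion measure to be the measure that assigns weight `4^{-|ω|}` to each
discrete excursion `ω`"). [cite: Kozdron2005, §3.5 (after Definition 3.34)] -/
def excursionWeight (ω : RWPath Ω δ) : ℝ≥0∞ :=
  if IsExcursion Ω δ ω then (4⁻¹ : ℝ≥0∞) ^ ω.len else 0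

/-- The weight of an excursion is `4^{-|ω|}`. [cite: Kozdron2005, §3.5 (after Definition 3.34)] -/
theorem excursionWeight_of_isExcursion {ω : RWPath Ω δ} (h : IsExcursion Ω δ ω) :
    excursionWeight Ω δ ω = (4⁻¹ : ℝ≥0∞) ^ ω.len := by
  classical exact if_pos h

/-- Non-excursions have weight `0`. [folklore] -/
theorem excursionWeight_of_not_isExcursion {ω : RWPath Ω δ} (h : ¬ IsExcursion Ω δ ω) :
    excursionWeight Ω δ ω = 0 := by
  classical exact if_neg h

/-- `w(ω) ≤ 4^{-|ω|} ≤ 1`. [folklore] -/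
theorem excursionWeight_le_pow (ω : RWPath Ω δ) : excursionWeight Ω δ ω ≤ (4⁻¹ : ℝ≥0∞) ^ ω.len := by
  by_cases h : IsExcursion Ω δ ω
  · rw [excursionWeight_of_isExcursion h]
  · rw [excursionWeight_of_not_isExcursion h]; exact zero_le

/-- `w(ω) ≤ 1`. [folklore] -/
theorem excursionWeight_le_one (ω : RWPath Ω δ) : excursionWeight Ω δ ω ≤ 1 :=
  (excursionWeight_le_pow ω).trans (pow_le_one₀ zero_le (by norm_num))

/-- **Reversal symmetry of the weight**: `w(ω.reverse) = w(ω)`. [folklore] -/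
@[simp] theorem excursionWeight_reverse (ω : RWPath Ω δ) :
    excursionWeight Ω δ ω.reverse = excursionWeight Ω δ ω := by
  by_cases h : IsExcursion Ω δ ω
  · rw [excursionWeight_of_isExcursion h,
      excursionWeight_of_isExcursion ((isExcursion_reverse_iff ω).mpr h), len_reverse]
  · rw [excursionWeight_of_not_isExcursion h,
      excursionWeight_of_not_isExcursion (mt (isExcursion_reverse_iff ω).mp h)]

variable (δ) in
/-- `ω` **hits** the set `K ⊆ ℂ`: some vertex of `ω`, drawn at mesh `δ`, lies in `K`. [folklore] -/
def Hits (K : Set ℂ) (ω : RWPath Ω δ) : Prop := ∃ x ∈ ω.2.support, meshPoint δ x ∈ K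

end RWPath

/-! ### The excursion measure and the restricted masses -/

/-- **The simple-random-walk excursion measure of `Ω_δ`** (definition request
`LatticeModels.rwExcursionMeasure`): the measure on nearest-neighbour paths of `Ω_δ` giving each
excursion `ω = (ω₀, …, ω_n)` — `n ≥ 1`, `ω₀, ω_n ∈ meshBoundary Ω δ`, `ω₁, …, ω_{n-1}` off the
boundary — the mass `4^{-n}`, and mass `0` to every other path: `μ = Σ_ω w(ω) δ_ω`
(Kozdron: "the measure that assigns weight `4^{-|ω|}` to each discrete excursion `ω`"; Lawler's
normalisation, Lawler–Werner's differs by `2π`). [cite: Kozdron2005, §3.5 (after Definition 3.34)] -/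
def rwExcursionMeasure (Ω : Set ℂ) (δ : ℝ) : Measure (RWPath Ω δ) :=
  Measure.sum fun ω => RWPath.excursionWeight Ω δ ω • Measure.dirac ω

/-- **The excursion measure of a set of paths is the sum of the weights of its members**:
`μ(S) = Σ'_{ω} 𝟙_S(ω) w(ω)`. [folklore] -/
theorem rwExcursionMeasure_apply (Ω : Set ℂ) (δ : ℝ) (S : Set (RWPath Ω δ)) :
    rwExcursionMeasure Ω δ S = ∑' ω, S.indicator (RWPath.excursionWeight Ω δ) ω := by
  classical
  rw [rwExcursionMeasure, Measure.sum_apply _ (RWPath.measurableSet S)]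
  refine tsum_congr fun ω => ?_
  rw [Measure.smul_apply, smul_eq_mul, Measure.dirac_apply' _ (RWPath.measurableSet S),
    Set.indicator_apply, Set.indicator_apply]
  split_ifs <;> simp

/-- The mass of a single path is its weight. [folklore] -/
theorem rwExcursionMeasure_singleton (Ω : Set ℂ) (δ : ℝ) (ω : RWPath Ω δ) :
    rwExcursionMeasure Ω δ {ω} = RWPath.excursionWeight Ω δ ω := by
  rw [rwExcursionMeasure_apply, ← tsum_subtype, tsum_singleton (f := RWPath.excursionWeight Ω δ)]

/-- The total mass is the sum of all excursion weights. [folklore] -/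
theorem rwExcursionMeasure_univ (Ω : Set ℂ) (δ : ℝ) :
    rwExcursionMeasure Ω δ univ = ∑' ω, RWPath.excursionWeight Ω δ ω := by
  simp [rwExcursionMeasure_apply]

/-- **Reversal invariance of the excursion measure**: `μ(reverse ⁻¹' S) = μ(S)`. [folklore] -/
theorem rwExcursionMeasure_preimage_reverse (Ω : Set ℂ) (δ : ℝ) (S : Set (RWPath Ω δ)) :
    rwExcursionMeasure Ω δ (RWPath.reverse ⁻¹' S) = rwExcursionMeasure Ω δ S := by
  classical
  rw [rwExcursionMeasure_apply, rwExcursionMeasure_apply,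
    ← (RWPath.reverseEquiv (Ω := Ω) (δ := δ)).tsum_eq (fun ω => S.indicator _ ω)]
  refine tsum_congr fun ω => ?_
  simp only [RWPath.reverseEquiv_apply, Set.indicator_apply, Set.mem_preimage,
    RWPath.excursionWeight_reverse]

/-- **The mutual excursion mass of two boundary pieces**: the excursion measure of the paths from
the discrete arc of `A` to the discrete arc of `B` — Kozdron's
`μ^{RW}_{∂}(Γ, Υ) = Σ_{x ∈ Γ} Σ_{y ∈ Υ} μ^{RW}_{∂}(x, y)` evaluated on all excursions, with
`Γ = discreteArc Ω δ A`, `Υ = discreteArc Ω δ B`. [cite: Kozdron2005, §3.5 (after Definition 3.34)] -/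
def rwExcursionMass (Ω : Set ℂ) (δ : ℝ) (A B : Set ℂ) : ℝ≥0∞ :=
  rwExcursionMeasure Ω δ {ω | ω.start ∈ discreteArc Ω δ A ∧ ω.finish ∈ discreteArc Ω δ B}

/-- The mutual excursion mass of `A` and `B` restricted to the excursions **hitting** a set
`K ⊆ ℂ` (e.g. a hull), the paths being drawn at mesh `δ`. [folklore] -/
def rwExcursionMassHitting (Ω : Set ℂ) (δ : ℝ) (A B K : Set ℂ) : ℝ≥0∞ :=
  rwExcursionMeasure Ω δ
    {ω | ω.start ∈ discreteArc Ω δ A ∧ ω.finish ∈ discreteArc Ω δ B ∧ RWPath.Hits δ K ω}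

/-- Unfolding lemma for `rwExcursionMass`. [folklore] -/
theorem rwExcursionMass_eq_tsum (Ω : Set ℂ) (δ : ℝ) (A B : Set ℂ) :
    rwExcursionMass Ω δ A B = ∑' ω : RWPath Ω δ,
      {ω : RWPath Ω δ | ω.start ∈ discreteArc Ω δ A ∧ ω.finish ∈ discreteArc Ω δ B}.indicator
        (RWPath.excursionWeight Ω δ) ω :=
  rwExcursionMeasure_apply _ _ _

/-- The hitting-restricted mass is at most the full mutual mass. [folklore] -/
theorem rwExcursionMassHitting_le (Ω : Set ℂ) (δ : ℝ) (A B K : Set ℂ) :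
    rwExcursionMassHitting Ω δ A B K ≤ rwExcursionMass Ω δ A B :=
  measure_mono fun _ h => ⟨h.1, h.2.1⟩

/-- **Reversal symmetry of the mutual excursion mass**: `μ(A, B) = μ(B, A)`. [folklore] -/
theorem rwExcursionMass_comm (Ω : Set ℂ) (δ : ℝ) (A B : Set ℂ) :
    rwExcursionMass Ω δ A B = rwExcursionMass Ω δ B A := by
  rw [rwExcursionMass, rwExcursionMass, ← rwExcursionMeasure_preimage_reverse Ω δ
    {ω : RWPath Ω δ | ω.start ∈ discreteArc Ω δ B ∧ ω.finish ∈ discreteArc Ω δ A}]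
  congr 1
  ext ω
  simp only [Set.mem_setOf_eq, Set.mem_preimage, RWPath.start_reverse, RWPath.finish_reverse]
  exact and_comm

end Literature.Probability.LatticeModels
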